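import Summits.Ventures.QEC.Census.CertBZInfoSets
import Summits.Ventures.QEC.Census.BB.BB144.BZAutData
import HarnessLib

/-!
# `BB144` — `bz` certificate, side Z: ENUMERATION verdicts 6/8, tier COMPILED (CHECKED-native; qec-search-7)

For each (block `b`, matrix `i`) listed: `cert.bzZEnum bzAutData b i = true` by `native_decide` — the
Brouwer–Zimmermann replay of matrix `i` of block `b`: every codeword `u · G_i` with `1 ≤ |u| ≤ t_i` has weight
`> wmax` or is allow-listed (CERT-FORMAT C4 / C17 (7)). ≈ 1.5·10⁷ codewords of 144 bits per matrix: measured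
≈ 100 s native each (qec-search-7 S1.BZS), KERNEL out of reach. Axiom `Lean.ofReduceBool`-class; propose with
`--computational`; NEVER counted as CERTIFIED. Structure (`BZStructZ`), information sets (`BZInfoSetsZ*`) and
bounds (`BZBoundsZ`) are KERNEL files.
-/

namespace Summit.Ventures.QEC.Census.BB144

/-- Block 10, matrix 0: the BZ enumeration verdict (`native_decide`, tier COMPILED). -/
theorem enumZ_10_0 : cert.bzZEnum bzAutData 10 0 = true := by
  native_decide

/-- Block 10, matrix 1: the BZ enumeration verdict (`native_decide`, tier COMPILED). -/
theorem enumZ_10_1 : cert.bzZEnum bzAutData 10 1 = true := by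
  native_decide

/-- Block 11, matrix 0: the BZ enumeration verdict (`native_decide`, tier COMPILED). -/
theorem enumZ_11_0 : cert.bzZEnum bzAutData 11 0 = true := by
  native_decide

/-- Block 11, matrix 1: the BZ enumeration verdict (`native_decide`, tier COMPILED). -/
theorem enumZ_11_1 : cert.bzZEnum bzAutData 11 1 = true := by
  native_decide

end Summit.Ventures.QEC.Census.BB144
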